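import Summits.QuantumFields.BalabanUV.Beta.EriceFlowEnclosureB12AsPrintedHistoryContagionShiftFlowZeroOffset
import Summits.QuantumFields.BalabanUV.Beta.EriceFlowEnclosureB12AsPrintedHistoryContagionShiftFlowZeroClock

/-!
# Beta / EriceFlowEnclosureB12AsPrintedHistoryContagionShiftFlowZeroLambda — ASYMPTOTIC FREEDOM IS CONTAGIOUS, part 35: THE RELATIVE Λ-PARAMETER AS A FUNCTION OF THE PIN
# AND ITS ABEL EQUATION `Λ(R g) = Λ(g) + β₀` — DIMENSIONAL TRANSMUTATION FOR THE FLOW WITH MEMORY NEAR ZERO PIN, FLOOR-FREE.  Part 34 made the chart offset of two box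
# solutions from small pins converge (`exists_relativeLambda`, constants (2∕3, 4∕3)); part 33 made the chart increments over k scales of every AF trajectory tend to k·β₀,
# β₀ = THE VALUE OF B AT THE ZERO HISTORY (part 32).  Here (§56, **`relativeLambda_exists`**) the offset against a fixed reference pin e′ is packaged as a FUNCTION OF THE
# PIN: `Λ : ℝ → ℝ`, `Λ e′ = 0`, `1∕h(n)² − 1∕h′(n)² → Λ e` for EVERY box solution h from every e ∈ ]0, e′]; **`(2∕3)(1∕e₁² − 1∕e₂²) ≤ Λ e₁ − Λ e₂ ≤ (4∕3)(1∕e₁² −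
# 1∕e₂²)`** (bi-Lipschitz in the chart 1∕e²); `StrictAntiOn` ∕ `ContinuousOn` on ]0, e′]; THE ABEL EQUATION **`Λ (h k) = Λ e + k·β₀`** along every solution — re-pinning k
# scales into the ultraviolet RAISES Λ BY EXACTLY k·β₀: in the coordinate Λ the renormalization group of the flow with memory IS THE RIGID TRANSLATION by the value at the zero
# history, and for part 31's one-step map `R g = solution B g 1` this is `Λ∘R = Λ + β₀` (**`relativeLambda_oneStep`**) — the discrete Abel ∕ Schröder linearisation of R at
# the trivial fixed point with the translation constant FORCED; and **Λ maps ]0, e′] ONTO [0, ∞[, each value attained at EXACTLY ONE pin**: near the trivial fixed point the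
# trajectories of the flow with memory are labelled equivalently by the infrared coupling e ∈ ]0, e′] or by Λ ∈ [0, ∞[, continuously and monotonically in both directions.
# Abstract in B (β-flow team, prover 1, unit `b2b-balaban-beta-bflow-p1`, gen 39; ROW AP-I·Uc × ROW Λ × NODE U2 — the Λ-parameter near zero pin, the function)

HONEST FRAMING (page 1 of everything the β sub-cell writes): discharging `BetaPertH` makes Bałaban's UV stability UNCONDITIONAL — a
real constructive-QFT result; it is NOT the continuum limit and NOT the Clay problem.  HONEST DEPENDENCY (cell reorg 2026-08-19,
verbatim): «continuum YM on T⁴ ⇐ BetaPertH ∧ nine spine estimates (0/9 proved); BetaPertH ⇐ (D1) ∧ (D4) ∧ CAP+tail; G-an2-4 gates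
asym, D1 and NE2/3/4.»  THIS MODULE DISCHARGES NOTHING: elementary real analysis (`limUnder` of convergent sequences, uniqueness of limits, the intermediate value theorem)
over node U2's HYPOTHESIS SHAPES `T4BetaStationary.{SeqBox, MemoryProfile}`, `T4BetaFlowWellPosed.{MemFlow, solution}` on an ABSTRACT functional `B`; part 34's
`exists_relativeLambda ∕ package_of_le ∕ succ_le_of_reference_flow`, part 33's `tendsto_invSq_shift_sub`, part 14's `sep_twoSided_of_reference_flow`, part 13's
`memFlow_solution_of_reference ∕ eq_solution_of_memFlow_of_reference`, part 10's `invSq_lower_of_reference_flow`, d4-p2's `EriceRemainderEnclosureHistoryAutonomyOrder.memFlow_tail`,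
node U2's `one_div_sq_one_div_sqrt` BY NAME — nothing restated.  PRECEDENTS (by name, not imported): ROW Λ (#35 `EriceFlowEnclosureLambdaParameter.lambda_exists` ∕ #35b
`…Transmutation`: the MARKOV recursion (3.62) of ONE function β under clause (L), `Λ(H(s, m)) = Λ(s) − m·β(0⁺)`); d4-p2's AUTONOMY row (E53c) `…RelativeLambdaInterval`
(relative Λ continuous, strictly decreasing, onto a COMPACT interval of pins — GIVEN a floor `b > 0` on the whole box and a zeroth moment, in a uniqueness regime).  Here: NO
floor, the box ARBITRARY against the profile, ONE AF reference; the image is the HALF-LINE [0, ∞[ (the ultraviolet end included) and the Abel constant is DERIVED (= B(0⁺)).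
`ScaleShiftRate` (GAPS G-t4-U2-1), `HistLipschitz`∕`FadingMemory` (G-t4-U2-2), [I] THEOREM 2 (p. 259, STATED WITHOUT PROOF) do not occur in this abstract part (carrier END:
part 36); NOTHING is asserted about Bałaban's β; «Λ-parameter» ∕ «dimensional transmutation» are this file's READING, not print.  [I] = T. Bałaban, Commun. Math. Phys.
**109** (1987) 249–301 [Balaban1987RG1].

WHAT THIS FILE PROVES (0 sorry, 0 def): §56 **`relativeLambda_exists`** (Λ e′ = 0; limits for every box solution from every pin of ]0, e′]; two-sided chart bounds;
`StrictAntiOn`; `ContinuousOn`; THE ABEL EQUATION `Λ (h k) = Λ e + k·β₀`; onto [0, ∞[ with unique pins), **`relativeLambda_oneStep`** (`solution B e 1 ∈ ]0, e′]` and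
`Λ (solution B e 1) = Λ e + β₀`).  NOT CLAIMED: an ABSOLUTE Λ (`lim (1∕h(n)² − nβ₀)` — false at this generality, part 37); two-loop asymptotics of Λ; regularity of Λ
beyond bi-Lipschitz-in-the-chart; anything about Bałaban's β; `BetaPertH`; continuum; Clay.
-/

namespace Summit.QuantumFields.BalabanUV.Beta.EriceFlowEnclosureB12AsPrintedHistoryContagionShiftFlowZeroLambda

open Finset Filter Topology Set
open Literature.MathematicalPhysics.QuantumFieldTheory.Balaban1983to89
open Literature.MathematicalPhysics.QuantumFieldTheory.Balaban1983to89.T4BetaStationary (SeqBox MemoryProfile)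
open Literature.MathematicalPhysics.QuantumFieldTheory.Balaban1983to89.T4BetaFlowWellPosed (MemFlow solution seqBox_shift one_div_sq_one_div_sqrt)
open Summit.QuantumFields.BalabanUV.Beta.EriceRemainderEnclosureHistoryAutonomyOrder (memFlow_tail)
open Summit.QuantumFields.BalabanUV.Beta.EriceFlowEnclosureB12AsPrintedHistoryContagionShiftFlow (invSq_lower_of_reference_flow)
open Summit.QuantumFields.BalabanUV.Beta.EriceFlowEnclosureB12AsPrintedHistoryContagionShiftFlowPicardLimit (memFlow_solution_of_reference
  eq_solution_of_memFlow_of_reference)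
open Summit.QuantumFields.BalabanUV.Beta.EriceFlowEnclosureB12AsPrintedHistoryContagionShiftFlowPicardPin (sep_twoSided_of_reference_flow)
open Summit.QuantumFields.BalabanUV.Beta.EriceFlowEnclosureB12AsPrintedHistoryContagionShiftFlowZeroClock (tendsto_invSq_shift_sub)
open Summit.QuantumFields.BalabanUV.Beta.EriceFlowEnclosureB12AsPrintedHistoryContagionShiftFlowZeroOffset (package_of_le succ_le_of_reference_flow exists_relativeLambda)

noncomputable section

/-! ## §56 The relative Λ-parameter as a function of the pin: bi-Lipschitz, monotone, continuous, Abel equation, onto a half-line -/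

/-- **THE RELATIVE Λ-PARAMETER NEAR ZERO PIN AND ITS ABEL EQUATION.**  `B` with memory profile `(C_m, θ)` on ]0, γ]^ℕ (0 ≤ θ < 1, C_m ≥ 0) and the value β₀ at the zero
history (part 32); ONE AF reference t; a reference pin e′ with part 14's package (`2e′ ≤ γ`, `4C_m e′ ≤ β*(1 − θ)`, `e′²·Q ≤ 3∕4`, `64C_m e′³ ≤ (1 − θ)²`, `C_m(8e′³ + 16e′∕β*) ≤
(1 − θ)∕4`) and a box solution h′ from e′.  THEN there is `Λ : ℝ → ℝ` with: (o) `Λ e′ = 0`; (i) for every pin `e ∈ ]0, e′]` and EVERY box solution h from e,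
`1∕h(n)² − 1∕h′(n)² → Λ e`; (ii) for `e₁ ≤ e₂` in ]0, e′]: **`(2∕3)(1∕e₁² − 1∕e₂²) ≤ Λ e₁ − Λ e₂ ≤ (4∕3)(1∕e₁² − 1∕e₂²)`** (bi-Lipschitz in the chart 1∕e²);
(iii) `StrictAntiOn Λ ]0, e′]`; (iv) `ContinuousOn Λ ]0, e′]`; (v) THE ABEL EQUATION: for every pin `e ∈ ]0, e′]`, every box solution h from e and every k,
**`Λ (h k) = Λ e + k·β₀`** — re-pinning k scales into the ultraviolet raises Λ by exactly k·β₀, β₀ = B(0⁺): in the coordinate Λ the renormalization group IS THE RIGID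
TRANSLATION by the value at the zero history; (vi) **Λ maps ]0, e′] ONTO [0, ∞[, every value attained at EXACTLY ONE pin** — the trajectories near the trivial fixed point
are labelled equivalently by the infrared coupling or by Λ.  (Row Λ's `lambda_exists` is the Markov (3.62) version under clause (L); d4-p2's (E53c) the floored version
on a compact pin interval.) [cite: Balaban1987RG1, Thm 2 (0.31) p.259 with (0.20) p.256 and p.298] -/
theorem relativeLambda_exists {B : (ℕ → ℝ) → ℝ} {Cm θ γ β₀ bs ta gs e' : ℝ} {t h' : ℕ → ℝ}
    (hB : MemoryProfile Cm θ γ B) (hCm : 0 ≤ Cm) (hθ0 : 0 ≤ θ) (hθ1 : θ < 1) (hbs : 0 < bs) (hta : 0 < ta)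
    (h0 : ∀ u : ℕ → ℝ, SeqBox γ u → |B u - β₀| ≤ Cm * ∑' j, θ ^ j * u j)
    (hts : SeqBox γ t) (htf : MemFlow B gs t) (hprof : ∀ m : ℕ, 1 / ta ^ 2 + bs * (m : ℝ) ≤ 1 / (t m) ^ 2)
    (he' : 0 < e') (h2e' : 2 * e' ≤ γ)
    (hs1 : 4 * Cm * e' ≤ bs * (1 - θ))
    (hs2 : e' ^ 2 * (1 / gs ^ 2 + Cm * γ / (1 - θ) ^ 2 + (2 * Cm / ((1 - θ) * bs)) ^ 2) ≤ 3 / 4)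
    (hs4 : 64 * Cm * e' ^ 3 ≤ (1 - θ) ^ 2) (hs5 : Cm * (8 * e' ^ 3 + 16 * e' / bs) ≤ (1 - θ) / 4)
    (hhs' : SeqBox γ h') (hhf' : MemFlow B e' h') :
    ∃ Λ : ℝ → ℝ, Λ e' = 0 ∧
      (∀ e ∈ Ioc 0 e', ∀ h : ℕ → ℝ, SeqBox γ h → MemFlow B e h → Tendsto (fun n => 1 / h n ^ 2 - 1 / h' n ^ 2) atTop (𝓝 (Λ e))) ∧
      (∀ e₁ ∈ Ioc 0 e', ∀ e₂ ∈ Ioc 0 e', e₁ ≤ e₂ →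
        2 / 3 * (1 / e₁ ^ 2 - 1 / e₂ ^ 2) ≤ Λ e₁ - Λ e₂ ∧ Λ e₁ - Λ e₂ ≤ 4 / 3 * (1 / e₁ ^ 2 - 1 / e₂ ^ 2)) ∧
      StrictAntiOn Λ (Ioc 0 e') ∧ ContinuousOn Λ (Ioc 0 e') ∧
      (∀ e ∈ Ioc 0 e', ∀ h : ℕ → ℝ, SeqBox γ h → MemFlow B e h → ∀ k : ℕ, Λ (h k) = Λ e + (k : ℝ) * β₀) ∧
      (∀ y : ℝ, 0 ≤ y → ∃! e : ℝ, e ∈ Ioc 0 e' ∧ Λ e = y) := by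
  have h1θ : 0 < 1 - θ := by linarith
  have hγ : 0 ≤ γ := by linarith
  -- the package at every pin of ]0, e′], and THE solution there
  have hpk : ∀ e ∈ Ioc (0 : ℝ) e', 4 * Cm * e ≤ bs * (1 - θ) ∧
      e ^ 2 * (1 / gs ^ 2 + Cm * γ / (1 - θ) ^ 2 + (2 * Cm / ((1 - θ) * bs)) ^ 2) ≤ 3 / 4 ∧
      64 * Cm * e ^ 3 ≤ (1 - θ) ^ 2 ∧ Cm * (8 * e ^ 3 + 16 * e / bs) ≤ (1 - θ) / 4 :=
    fun e he => package_of_le hCm hθ1 hbs hγ he.1 he.2 hs1 hs2 hs4 hs5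
  have hsol : ∀ e ∈ Ioc (0 : ℝ) e', SeqBox γ (solution B e) ∧ MemFlow B e (solution B e) := by
    intro e he
    obtain ⟨p1, p2, p4, -⟩ := hpk e he
    obtain ⟨hss, hsf, -, -⟩ := memFlow_solution_of_reference hB hCm hθ0 hθ1 hbs hta hts htf hprof he.1 (by linarith [he.2]) p1 p2 p4
    exact ⟨hss, hsf⟩
  have huniq : ∀ e ∈ Ioc (0 : ℝ) e', ∀ h : ℕ → ℝ, SeqBox γ h → MemFlow B e h → h = solution B e := by
    intro e he h hhs hhf
    obtain ⟨p1, p2, p4, -⟩ := hpk e he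
    exact eq_solution_of_memFlow_of_reference hB hCm hθ0 hθ1 hbs hta hts htf hprof he.1 (by linarith [he.2]) p1 p2 p4 hhs hhf
  have he'mem : e' ∈ Ioc (0 : ℝ) e' := ⟨he', le_rfl⟩
  have hh'eq : h' = solution B e' := huniq e' he'mem h' hhs' hhf'
  -- the function Λ
  set Λ : ℝ → ℝ := fun e => limUnder atTop (fun n => 1 / (solution B e n) ^ 2 - 1 / h' n ^ 2) with hΛdef
  have hΛ : ∀ e ∈ Ioc (0 : ℝ) e', Tendsto (fun n => 1 / (solution B e n) ^ 2 - 1 / h' n ^ 2) atTop (𝓝 (Λ e)) := by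
    intro e he
    obtain ⟨hss, hsf⟩ := hsol e he
    obtain ⟨Θ, hΘ, -⟩ := exists_relativeLambda hB hCm hθ0 hθ1 hbs hta hts htf hprof he.1 he.2 h2e' hs1 hs2 hs4 hs5 hss hsf hhs' hhf'
    have e1 : Λ e = Θ := hΘ.limUnder_eq
    rw [e1]; exact hΘ
  have hΛh : ∀ e ∈ Ioc (0 : ℝ) e', ∀ h : ℕ → ℝ, SeqBox γ h → MemFlow B e h →
      Tendsto (fun n => 1 / h n ^ 2 - 1 / h' n ^ 2) atTop (𝓝 (Λ e)) := by
    intro e he h hhs hhf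
    rw [huniq e he h hhs hhf]
    exact hΛ e he
  have hΛ0 : Λ e' = 0 := by
    have h : Tendsto (fun n => 1 / (solution B e' n) ^ 2 - 1 / h' n ^ 2) atTop (𝓝 (0 : ℝ)) := by
      rw [← hh'eq]; simp only [sub_self]; exact tendsto_const_nhds
    exact h.limUnder_eq
  -- (ii) two-sided bounds for pairs
  have hbounds : ∀ e₁ ∈ Ioc (0 : ℝ) e', ∀ e₂ ∈ Ioc (0 : ℝ) e', e₁ ≤ e₂ →
      2 / 3 * (1 / e₁ ^ 2 - 1 / e₂ ^ 2) ≤ Λ e₁ - Λ e₂ ∧ Λ e₁ - Λ e₂ ≤ 4 / 3 * (1 / e₁ ^ 2 - 1 / e₂ ^ 2) := by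
    intro e₁ he₁ e₂ he₂ h12
    obtain ⟨hss₁, hsf₁⟩ := hsol e₁ he₁
    obtain ⟨hss₂, hsf₂⟩ := hsol e₂ he₂
    obtain ⟨p1, p2, p4, p5⟩ := hpk e₂ he₂
    have hpair : Tendsto (fun n => 1 / (solution B e₁ n) ^ 2 - 1 / (solution B e₂ n) ^ 2) atTop (𝓝 (Λ e₁ - Λ e₂)) :=
      ((hΛ e₁ he₁).sub (hΛ e₂ he₂)).congr fun n => by ring
    have hk := fun n => sep_twoSided_of_reference_flow hB hCm hθ0 hθ1 hbs hta hts htf hprof he₁.1 h12 (by linarith [he₂.2]) p1 p2 p4 p5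
      hss₁ hsf₁ hss₂ hsf₂ n
    exact ⟨ge_of_tendsto' hpair fun n => (hk n).1, le_of_tendsto' hpair fun n => (hk n).2⟩
  -- (iii) strictly decreasing
  have hanti : StrictAntiOn Λ (Ioc 0 e') := by
    intro e₁ he₁ e₂ he₂ h12
    have hΔ : 0 < 1 / e₁ ^ 2 - 1 / e₂ ^ 2 := by
      rw [sub_pos]; exact one_div_lt_one_div_of_lt (by have := he₁.1; positivity) (pow_lt_pow_left₀ h12 he₁.1.le two_ne_zero)
    have := (hbounds e₁ he₁ e₂ he₂ h12.le).1
    show Λ e₂ < Λ e₁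
    linarith
  -- (iv) continuous
  have hcont : ContinuousOn Λ (Ioc 0 e') := by
    have hinv : ContinuousOn (fun s : ℝ => 1 / s ^ 2) (Ioc 0 e') :=
      continuousOn_const.div (continuousOn_id.pow 2) fun s hs => (pow_pos hs.1 2).ne'
    rw [Metric.continuousOn_iff] at hinv ⊢
    intro s hs ε hε
    obtain ⟨η, hη, hηs⟩ := hinv s hs (ε / 2) (by positivity)
    refine ⟨η, hη, fun s' hs' hd => ?_⟩
    have h1 := hηs s' hs' hd
    rw [Real.dist_eq] at h1 ⊢
    rcases le_total s' s with hle | hle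
    · have h2 := hbounds s' hs' s hs hle
      rw [abs_of_nonneg (by linarith [h2.1, (abs_nonneg (1 / s' ^ 2 - 1 / s ^ 2))] : (0 : ℝ) ≤ Λ s' - Λ s)]
      have : 1 / s' ^ 2 - 1 / s ^ 2 ≤ |1 / s' ^ 2 - 1 / s ^ 2| := le_abs_self _
      linarith [h2.2]
    · have h2 := hbounds s hs s' hs' hle
      rw [abs_sub_comm, abs_of_nonneg (by linarith [h2.1, (abs_nonneg (1 / s ^ 2 - 1 / s' ^ 2))] : (0 : ℝ) ≤ Λ s - Λ s')]
      have : 1 / s ^ 2 - 1 / s' ^ 2 ≤ |1 / s' ^ 2 - 1 / s ^ 2| := by rw [abs_sub_comm]; exact le_abs_self _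
      linarith [h2.2]
  -- (v) the Abel equation
  have habel : ∀ e ∈ Ioc (0 : ℝ) e', ∀ h : ℕ → ℝ, SeqBox γ h → MemFlow B e h → ∀ k : ℕ, Λ (h k) = Λ e + (k : ℝ) * β₀ := by
    intro e he h hhs hhf k
    obtain ⟨p1, p2, -, -⟩ := hpk e he
    -- the running value h k is a pin of ]0, e′] and the tail is THE solution from it
    have hmono := succ_le_of_reference_flow hB hCm hθ0 hθ1 hbs hta h0 hts htf hprof hhs hhf p1 p2 k
    have hkmem : h k ∈ Ioc (0 : ℝ) e' := ⟨(hhs k).1, hmono.2.2.trans he.2⟩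
    have htail_lim := hΛh (h k) hkmem (fun j => h (k + j)) (seqBox_shift hhs k) (memFlow_tail hhf k)
    have hlim := hΛh e he h hhs hhf
    -- the difference of the two offsets is the chart increment over k scales, which tends to kβ₀ (part 32)
    have hprofh : ∀ m : ℕ, 1 / (2 * e) ^ 2 + bs / 4 * (m : ℝ) ≤ 1 / (h m) ^ 2 := fun m => by
      have := invSq_lower_of_reference_flow hB hCm hθ0 hθ1 hbs hta hts htf hprof hhs hhf p1 p2 m
      rwa [show (1 : ℝ) / (2 * e) ^ 2 = 1 / (4 * e ^ 2) by ring]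
    have hshift := tendsto_invSq_shift_sub hCm hθ0 hθ1 (by positivity : 0 < bs / 4) (by have := he.1; positivity : 0 < 2 * e) h0 hhs hhf hprofh k
    have hdiff : Tendsto (fun n => (1 / h (k + n) ^ 2 - 1 / h' n ^ 2) - (1 / h n ^ 2 - 1 / h' n ^ 2)) atTop (𝓝 (Λ (h k) - Λ e)) :=
      htail_lim.sub hlim
    have hdiff' : Tendsto (fun n => (1 / h (k + n) ^ 2 - 1 / h' n ^ 2) - (1 / h n ^ 2 - 1 / h' n ^ 2)) atTop (𝓝 ((k : ℝ) * β₀)) :=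
      hshift.congr fun n => by rw [Nat.add_comm]; ring
    linarith [tendsto_nhds_unique hdiff hdiff']
  -- (vi) onto [0, ∞[ with unique pins
  have hsurj : ∀ y : ℝ, 0 ≤ y → ∃! e : ℝ, e ∈ Ioc 0 e' ∧ Λ e = y := by
    intro y hy
    -- a pin e₀ with `(2∕3)(1∕e₀² − 1∕e′²) = y`
    set S : ℝ := 1 / e' ^ 2 + 3 / 2 * y with hS
    have hS0 : 0 < S := by positivity
    set e₀ : ℝ := 1 / Real.sqrt S with he₀
    have he₀0 : 0 < e₀ := one_div_pos.mpr (Real.sqrt_pos.mpr hS0)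
    have he₀sq : 1 / e₀ ^ 2 = S := one_div_sq_one_div_sqrt hS0
    have he₀le : e₀ ≤ e' := by
      have h1 : 1 / e' ^ 2 ≤ 1 / e₀ ^ 2 := by rw [he₀sq, hS]; linarith
      have h2 : e₀ ^ 2 ≤ e' ^ 2 := (one_div_le_one_div (pow_pos he' 2) (pow_pos he₀0 2)).mp h1
      exact (pow_le_pow_iff_left₀ he₀0.le he'.le two_ne_zero).mp h2
    have he₀mem : e₀ ∈ Ioc (0 : ℝ) e' := ⟨he₀0, he₀le⟩
    have hge : y ≤ Λ e₀ := by
      have := (hbounds e₀ he₀mem e' he'mem he₀le).1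
      rw [hΛ0, he₀sq, hS] at this
      linarith
    -- intermediate values on [e₀, e′]
    have hIcc : Icc e₀ e' ⊆ Ioc 0 e' := fun x hx => ⟨he₀0.trans_le hx.1, hx.2⟩
    have hivt := intermediate_value_Icc' he₀le (hcont.mono hIcc)
    have hy' : y ∈ Icc (Λ e') (Λ e₀) := ⟨by rw [hΛ0]; exact hy, hge⟩
    obtain ⟨x, hx, hxy⟩ := hivt hy'
    refine ⟨x, ⟨hIcc hx, hxy⟩, fun x' hx' => ?_⟩
    exact hanti.injOn hx'.1 (hIcc hx) (hx'.2.trans hxy.symm)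
  exact ⟨Λ, hΛ0, hΛh, hbounds, hanti, hcont, habel, hsurj⟩

/-- **`Λ∘R = Λ + β₀` FOR THE ONE-STEP RENORMALIZATION MAP** (part 31's `R g = solution B g 1`): under the data of `relativeLambda_exists`, its function Λ satisfies
`Λ (solution B e 1) = Λ e + β₀` for every pin `e ∈ ]0, e′]` — the discrete ABEL EQUATION of the one-step map, translation constant = the value of B at the zero history.
[cite: Balaban1987RG1, Thm 2 (0.31) p.259 with (0.20) p.256 and p.298] -/
theorem relativeLambda_oneStep {B : (ℕ → ℝ) → ℝ} {Cm θ γ β₀ bs ta gs e' : ℝ} {t h' : ℕ → ℝ}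
    (hB : MemoryProfile Cm θ γ B) (hCm : 0 ≤ Cm) (hθ0 : 0 ≤ θ) (hθ1 : θ < 1) (hbs : 0 < bs) (hta : 0 < ta)
    (h0 : ∀ u : ℕ → ℝ, SeqBox γ u → |B u - β₀| ≤ Cm * ∑' j, θ ^ j * u j)
    (hts : SeqBox γ t) (htf : MemFlow B gs t) (hprof : ∀ m : ℕ, 1 / ta ^ 2 + bs * (m : ℝ) ≤ 1 / (t m) ^ 2)
    (he' : 0 < e') (h2e' : 2 * e' ≤ γ)
    (hs1 : 4 * Cm * e' ≤ bs * (1 - θ))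
    (hs2 : e' ^ 2 * (1 / gs ^ 2 + Cm * γ / (1 - θ) ^ 2 + (2 * Cm / ((1 - θ) * bs)) ^ 2) ≤ 3 / 4)
    (hs4 : 64 * Cm * e' ^ 3 ≤ (1 - θ) ^ 2) (hs5 : Cm * (8 * e' ^ 3 + 16 * e' / bs) ≤ (1 - θ) / 4)
    (hhs' : SeqBox γ h') (hhf' : MemFlow B e' h') :
    ∃ Λ : ℝ → ℝ, Λ e' = 0 ∧ StrictAntiOn Λ (Ioc 0 e') ∧ ContinuousOn Λ (Ioc 0 e') ∧
      (∀ e ∈ Ioc 0 e', Tendsto (fun n => 1 / (solution B e n) ^ 2 - 1 / h' n ^ 2) atTop (𝓝 (Λ e))) ∧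
      ∀ e ∈ Ioc 0 e', solution B e 1 ∈ Ioc 0 e' ∧ Λ (solution B e 1) = Λ e + β₀ := by
  have hγ : 0 ≤ γ := by linarith
  obtain ⟨Λ, hΛ0, hΛh, -, hanti, hcont, habel, -⟩ :=
    relativeLambda_exists hB hCm hθ0 hθ1 hbs hta h0 hts htf hprof he' h2e' hs1 hs2 hs4 hs5 hhs' hhf'
  refine ⟨Λ, hΛ0, hanti, hcont, fun e he => ?_, fun e he => ?_⟩
  · obtain ⟨p1, p2, p4, -⟩ := package_of_le hCm hθ1 hbs hγ he.1 he.2 hs1 hs2 hs4 hs5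
    obtain ⟨hss, hsf, -, -⟩ := memFlow_solution_of_reference hB hCm hθ0 hθ1 hbs hta hts htf hprof he.1 (by linarith [he.2]) p1 p2 p4
    exact hΛh e he _ hss hsf
  · obtain ⟨p1, p2, p4, -⟩ := package_of_le hCm hθ1 hbs hγ he.1 he.2 hs1 hs2 hs4 hs5
    obtain ⟨hss, hsf, -, -⟩ := memFlow_solution_of_reference hB hCm hθ0 hθ1 hbs hta hts htf hprof he.1 (by linarith [he.2]) p1 p2 p4
    have hmono := succ_le_of_reference_flow hB hCm hθ0 hθ1 hbs hta h0 hts htf hprof hss hsf p1 p2 1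
    have h := habel e he _ hss hsf 1
    simp only [Nat.cast_one, one_mul] at h
    exact ⟨⟨(hss 1).1, hmono.2.2.trans he.2⟩, h⟩

end

end Summit.QuantumFields.BalabanUV.Beta.EriceFlowEnclosureB12AsPrintedHistoryContagionShiftFlowZeroLambda
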